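import Literature.Combinatorics.Designs.SixTurynType

/-!
# Hadamard 668 census — sum-of-squares TYPES on the whole 6-Turyn-type line `2m + n = 167`, certified in the kernel

Framing: lottery ticket; floor = certified bounds/negative ranges.

Cell pub-namedobj (venture DiscreteObjects), target (H).  Companion of `SixTurynTypeFamily668.lean` and
`TurynTypeFamily668Types.lean`: for 6-Turyn-type sequences `(x; y; z; w)` of lengths `m, m, m, n` with `2m + n = 167`
the element sums satisfy `X² + Y² + 2Z² + 2W² = 334` (`sixTurynType167_sum_sq`), `X ≡ Y ≡ Z ≡ m (mod 2)` and
`W ≡ n ≡ 1 (mod 2)`.  Hence the absolute sums fall into one of two finite TYPE TABLES according to the parity of `m`,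
each certified complete by `decide +kernel` (`sixTurynType167_type_even`, `sixTurynType167_type_odd`):
* `m` even (e.g. `TT(56)`): the 12 types of `evenLineTypes` (`= TurynTypeFamily668Types.tt56Types`);
* `m` odd (e.g. `(m, n) = (83, 1), (57, 53)`): the 21 types of `oddLineTypes`.
Typed grammar of hypothetical objects; nothing is asserted to exist; HITS 0.  No `sorry`, no `native_decide`.
-/

open Finset BigOperators

namespace Summit.Ventures.DiscreteObjects.Hadamard

open Literature.Combinatorics.Designs.TSequences
open Literature.Combinatorics.Designs.BaseSequences
open Literature.Combinatorics.Designs.SixTurynType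

/-- a `±1` sum of length `L` is `L - 2k`. -/
private theorem sum_pm_parity₆ {x : ℕ → ℤ} : ∀ {L : ℕ}, PMOn L x → ∃ k : ℤ, ∑ i ∈ range L, x i = L - 2 * k
  | 0, _ => ⟨0, by simp⟩
  | L + 1, hx => by
      obtain ⟨k, hk⟩ := sum_pm_parity₆ (L := L) fun i hi => hx i (Nat.lt_succ_of_lt hi)
      rw [Finset.sum_range_succ, hk]
      rcases hx L (Nat.lt_succ_self L) with h | h
      · exact ⟨k, by rw [h]; push_cast; ring⟩
      · exact ⟨k + 1, by rw [h]; push_cast; ring⟩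

/-- the absolute value of `L - 2k` has the parity of `L`. -/
private lemma natAbs_mod_two₆ {X k : ℤ} {L : ℕ} (h : X = L - 2 * k) : X.natAbs % 2 = L % 2 := by
  rcases Int.natAbs_eq X with e | e <;> omega

/-- `(|X| : ℤ)² = X²`. -/
private lemma natAbs_sq_cast₆ (X : ℤ) : ((X.natAbs : ℕ) : ℤ) ^ 2 = X ^ 2 := by
  rw [Int.natCast_natAbs, sq_abs]

/-- the 12 types `[min |X| |Y|, max |X| |Y|, |Z|, |W|]` on the line for EVEN `m` (`X, Y, Z` even, `W` odd). -/
def evenLineTypes : List (List ℕ) :=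
  [[0, 6, 10, 7], [0, 10, 6, 9], [0, 18, 2, 1], [2, 4, 6, 11], [2, 16, 6, 1], [4, 10, 10, 3], [4, 14, 6, 5],
    [6, 8, 6, 9], [8, 10, 2, 9], [8, 10, 6, 7], [8, 14, 6, 1], [10, 12, 6, 3]]

/-- the 21 types `[min |X| |Y|, max |X| |Y|, |Z|, |W|]` on the line for ODD `m` (all four sums odd). -/
def oddLineTypes : List (List ℕ) :=
  [[1, 3, 9, 9], [1, 11, 5, 9], [1, 11, 9, 5], [1, 13, 1, 9], [1, 13, 9, 1], [3, 9, 1, 11], [3, 9, 11, 1],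
    [3, 15, 1, 7], [3, 15, 5, 5], [3, 15, 7, 1], [3, 17, 3, 3], [5, 7, 3, 11], [5, 7, 7, 9], [5, 7, 9, 7],
    [5, 7, 11, 3], [5, 17, 1, 3], [5, 17, 3, 1], [7, 11, 1, 9], [7, 11, 9, 1], [7, 13, 3, 7], [7, 13, 7, 3]]

/-- completeness of `evenLineTypes` over the box (kernel enumeration over `Fin 10² × Fin 7²`). -/
theorem evenLineTypes_complete : ∀ a b : Fin 10, ∀ c d : Fin 7,
    (2 * a.val) ^ 2 + (2 * b.val) ^ 2 + 2 * (2 * c.val) ^ 2 + 2 * (2 * d.val + 1) ^ 2 = 334 →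
    [min (2 * a.val) (2 * b.val), max (2 * a.val) (2 * b.val), 2 * c.val, 2 * d.val + 1] ∈ evenLineTypes := by
  decide +kernel

/-- completeness of `oddLineTypes` over the box (kernel enumeration over `Fin 9² × Fin 7²`). -/
theorem oddLineTypes_complete : ∀ a b : Fin 9, ∀ c d : Fin 7,
    (2 * a.val + 1) ^ 2 + (2 * b.val + 1) ^ 2 + 2 * (2 * c.val + 1) ^ 2 + 2 * (2 * d.val + 1) ^ 2 = 334 →
    [min (2 * a.val + 1) (2 * b.val + 1), max (2 * a.val + 1) (2 * b.val + 1), 2 * c.val + 1, 2 * d.val + 1]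
      ∈ oddLineTypes := by
  decide +kernel

/-- **type table on the line, `m` even**: for 6-Turyn-type `(x; y; z; w)` of lengths `m, m, m, n`, `2m + n = 167`,
`m` even, the list `[min |X| |Y|, max |X| |Y|, |Z|, |W|]` of absolute element sums lies in `evenLineTypes`. -/
theorem sixTurynType167_type_even {m n : ℕ} {x y z w : ℕ → ℤ} (h : IsSixTurynType m n x y z w)
    (hmn : m + n + m = 167) (hm : m % 2 = 0) :
    [min (∑ i ∈ range m, x i).natAbs (∑ i ∈ range m, y i).natAbs,
      max (∑ i ∈ range m, x i).natAbs (∑ i ∈ range m, y i).natAbs,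
      (∑ i ∈ range m, z i).natAbs, (∑ i ∈ range n, w i).natAbs] ∈ evenLineTypes := by
  have hsq := sixTurynType_sum_sq h
  have hc : (2 * (m : ℤ) + n) = 167 := by exact_mod_cast (by omega : 2 * m + n = 167)
  rw [hc] at hsq
  norm_num at hsq
  obtain ⟨hx, hy, hz, hw, -⟩ := h
  obtain ⟨kx, hkx⟩ := sum_pm_parity₆ hx
  obtain ⟨ky, hky⟩ := sum_pm_parity₆ hy
  obtain ⟨kz, hkz⟩ := sum_pm_parity₆ hz
  obtain ⟨kw, hkw⟩ := sum_pm_parity₆ hw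
  have pX := natAbs_mod_two₆ hkx
  have pY := natAbs_mod_two₆ hky
  have pZ := natAbs_mod_two₆ hkz
  have pW := natAbs_mod_two₆ hkw
  have hn1 : n % 2 = 1 := by omega
  rw [hn1] at pW
  rw [hm] at pX pY pZ
  generalize (∑ i ∈ range m, x i) = X at *
  generalize (∑ i ∈ range m, y i) = Y at *
  generalize (∑ i ∈ range m, z i) = Z at *
  generalize (∑ i ∈ range n, w i) = W at *
  have hN : X.natAbs ^ 2 + Y.natAbs ^ 2 + 2 * Z.natAbs ^ 2 + 2 * W.natAbs ^ 2 = 334 := by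
    have : ((X.natAbs : ℕ) : ℤ) ^ 2 + ((Y.natAbs : ℕ) : ℤ) ^ 2 + 2 * ((Z.natAbs : ℕ) : ℤ) ^ 2 +
        2 * ((W.natAbs : ℕ) : ℤ) ^ 2 = 334 := by
      rw [natAbs_sq_cast₆, natAbs_sq_cast₆, natAbs_sq_cast₆, natAbs_sq_cast₆]; linarith
    exact_mod_cast this
  clear hkx hky hkz hkw hsq hx hy hz hw hc hmn hn1
  obtain ⟨d, hd⟩ : ∃ d, W.natAbs = 2 * d + 1 := ⟨W.natAbs / 2, by omega⟩
  obtain ⟨a, ha⟩ : ∃ a, X.natAbs = 2 * a := ⟨X.natAbs / 2, by omega⟩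
  obtain ⟨b, hb⟩ : ∃ b, Y.natAbs = 2 * b := ⟨Y.natAbs / 2, by omega⟩
  obtain ⟨c, hc⟩ : ∃ c, Z.natAbs = 2 * c := ⟨Z.natAbs / 2, by omega⟩
  rw [ha, hb, hc, hd] at hN ⊢
  clear pX pY pZ pW ha hb hc hd
  have qa : (2 * a) ^ 2 ≤ 334 := by linarith [Nat.zero_le ((2 * b) ^ 2), Nat.zero_le ((2 * c) ^ 2), Nat.zero_le ((2 * d + 1) ^ 2)]
  have qb : (2 * b) ^ 2 ≤ 334 := by linarith [Nat.zero_le ((2 * a) ^ 2), Nat.zero_le ((2 * c) ^ 2), Nat.zero_le ((2 * d + 1) ^ 2)]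
  have qc : (2 * c) ^ 2 ≤ 167 := by linarith [Nat.zero_le ((2 * a) ^ 2), Nat.zero_le ((2 * b) ^ 2), Nat.zero_le ((2 * d + 1) ^ 2)]
  have qd : (2 * d + 1) ^ 2 ≤ 167 := by linarith [Nat.zero_le ((2 * a) ^ 2), Nat.zero_le ((2 * b) ^ 2), Nat.zero_le ((2 * c) ^ 2)]
  have ha' : a < 10 := by nlinarith [qa]
  have hb' : b < 10 := by nlinarith [qb]
  have hc' : c < 7 := by nlinarith [qc]
  have hd' : d < 7 := by nlinarith [qd]
  exact evenLineTypes_complete ⟨a, ha'⟩ ⟨b, hb'⟩ ⟨c, hc'⟩ ⟨d, hd'⟩ hN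

/-- **type table on the line, `m` odd**: the same list lies in `oddLineTypes` (all four sums odd). -/
theorem sixTurynType167_type_odd {m n : ℕ} {x y z w : ℕ → ℤ} (h : IsSixTurynType m n x y z w)
    (hmn : m + n + m = 167) (hm : m % 2 = 1) :
    [min (∑ i ∈ range m, x i).natAbs (∑ i ∈ range m, y i).natAbs,
      max (∑ i ∈ range m, x i).natAbs (∑ i ∈ range m, y i).natAbs,
      (∑ i ∈ range m, z i).natAbs, (∑ i ∈ range n, w i).natAbs] ∈ oddLineTypes := by
  have hsq := sixTurynType_sum_sq h
  have hc : (2 * (m : ℤ) + n) = 167 := by exact_mod_cast (by omega : 2 * m + n = 167)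
  rw [hc] at hsq
  norm_num at hsq
  obtain ⟨hx, hy, hz, hw, -⟩ := h
  obtain ⟨kx, hkx⟩ := sum_pm_parity₆ hx
  obtain ⟨ky, hky⟩ := sum_pm_parity₆ hy
  obtain ⟨kz, hkz⟩ := sum_pm_parity₆ hz
  obtain ⟨kw, hkw⟩ := sum_pm_parity₆ hw
  have pX := natAbs_mod_two₆ hkx
  have pY := natAbs_mod_two₆ hky
  have pZ := natAbs_mod_two₆ hkz
  have pW := natAbs_mod_two₆ hkw
  have hn1 : n % 2 = 1 := by omega
  rw [hn1] at pW
  rw [hm] at pX pY pZ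
  generalize (∑ i ∈ range m, x i) = X at *
  generalize (∑ i ∈ range m, y i) = Y at *
  generalize (∑ i ∈ range m, z i) = Z at *
  generalize (∑ i ∈ range n, w i) = W at *
  have hN : X.natAbs ^ 2 + Y.natAbs ^ 2 + 2 * Z.natAbs ^ 2 + 2 * W.natAbs ^ 2 = 334 := by
    have : ((X.natAbs : ℕ) : ℤ) ^ 2 + ((Y.natAbs : ℕ) : ℤ) ^ 2 + 2 * ((Z.natAbs : ℕ) : ℤ) ^ 2 +
        2 * ((W.natAbs : ℕ) : ℤ) ^ 2 = 334 := by
      rw [natAbs_sq_cast₆, natAbs_sq_cast₆, natAbs_sq_cast₆, natAbs_sq_cast₆]; linarith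
    exact_mod_cast this
  clear hkx hky hkz hkw hsq hx hy hz hw hc hmn hn1
  obtain ⟨d, hd⟩ : ∃ d, W.natAbs = 2 * d + 1 := ⟨W.natAbs / 2, by omega⟩
  obtain ⟨a, ha⟩ : ∃ a, X.natAbs = 2 * a + 1 := ⟨X.natAbs / 2, by omega⟩
  obtain ⟨b, hb⟩ : ∃ b, Y.natAbs = 2 * b + 1 := ⟨Y.natAbs / 2, by omega⟩
  obtain ⟨c, hc⟩ : ∃ c, Z.natAbs = 2 * c + 1 := ⟨Z.natAbs / 2, by omega⟩
  rw [ha, hb, hc, hd] at hN ⊢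
  clear pX pY pZ pW ha hb hc hd
  have qa : (2 * a + 1) ^ 2 ≤ 334 := by linarith [Nat.zero_le ((2 * b + 1) ^ 2), Nat.zero_le ((2 * c + 1) ^ 2), Nat.zero_le ((2 * d + 1) ^ 2)]
  have qb : (2 * b + 1) ^ 2 ≤ 334 := by linarith [Nat.zero_le ((2 * a + 1) ^ 2), Nat.zero_le ((2 * c + 1) ^ 2), Nat.zero_le ((2 * d + 1) ^ 2)]
  have qc : (2 * c + 1) ^ 2 ≤ 167 := by linarith [Nat.zero_le ((2 * a + 1) ^ 2), Nat.zero_le ((2 * b + 1) ^ 2), Nat.zero_le ((2 * d + 1) ^ 2)]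
  have qd : (2 * d + 1) ^ 2 ≤ 167 := by linarith [Nat.zero_le ((2 * a + 1) ^ 2), Nat.zero_le ((2 * b + 1) ^ 2), Nat.zero_le ((2 * c + 1) ^ 2)]
  have ha' : a < 9 := by nlinarith [qa]
  have hb' : b < 9 := by nlinarith [qb]
  have hc' : c < 7 := by nlinarith [qc]
  have hd' : d < 7 := by nlinarith [qd]
  exact oddLineTypes_complete ⟨a, ha'⟩ ⟨b, hb'⟩ ⟨c, hc'⟩ ⟨d, hd'⟩ hN

end Summit.Ventures.DiscreteObjects.Hadamard
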